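import Literature.MathematicalPhysics.QuantumManyBody.JelliumPairExpansion
import HarnessLib

/-!
# The pair-term blocks: diagonal blocks, symmetric pairs, and their `ℝ≥0∞` majorants

Topic `Literature/MathematicalPhysics/QuantumManyBody` (the charged Bose gas, `JelliumBoseGas.foldyLaw`).
Bookkeeping on top of the 16-block expansion `pair_expansion` (`JelliumPairExpansion.lean`) of
`∫_{Λⁿ} w(xᵢ,xⱼ)|Ψ|²` through the pieces `![PᵢPⱼΨ, PᵢQⱼΨ, QᵢPⱼΨ, QᵢQⱼΨ]` [LiebSolovej2001, §5]:

* `re_conj_mul_self`, `re_conj_mul_comm` — `Re(z̄z) = |z|²`, `Re(b̄a) = Re(āb)`;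
* `pair_expansion_grouped` — the 4 diagonal blocks `D_α = ∫w|piece_α|²` and the 6 symmetric pairs
  `2R_{αβ}`, `R_{αβ} = ∫ w Re(conj(piece_α) piece_β)`:
  `∫w|Ψ|² = D₀ + D₁ + D₂ + D₃ + 2(R₀₁ + R₀₂ + R₀₃ + R₁₂ + R₁₃ + R₂₃)`
  (`D₀ ↔ ŵ_{00,00}`, `D₁ + D₂ ↔ ŵ_{p0,q0}`, `D₃ ↔ ŵ_{pq,μν}`, `R₀₃ ↔` pairing `ŵ_{pq,00}`,
  `R₁₂ ↔` exchange `ŵ_{p0,0q}`, `R₀₁, R₀₂ ↔ ŵ_{p0,00}`, `R₁₃, R₂₃ ↔ ŵ_{pq,m0}`);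
* `diag_block_eq_toReal`, `abs_offdiag_block_le_toReal` — for `w ≥ 0` the blocks are controlled by
  the `ℝ≥0∞` integrals `∫⁻ w‖a‖₊²`, `∫⁻ w‖a‖₊‖b‖₊` to which the landed estimates
  (`JelliumLemma52/53`, `JelliumExchangeBound`, `JelliumCrossBlockBounds`) apply.

## References

* [LiebSolovej2001] E. H. Lieb, J. P. Solovej, Commun. Math. Phys. 217 (2001) 127–163, §5
  (arXiv:cond-mat/0007425, pp. 11–13).
-/

noncomputable section

open MeasureTheory Set Filter Real
open scoped ENNReal NNReal Topology ComplexConjugate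

namespace Literature.MathematicalPhysics.QuantumManyBody.JelliumBoseGas

open BoseGas

variable {n : ℕ} {ℓ : ℝ}

/-! ### Pointwise algebra -/

/-- `Re(z̄ z) = |z|²`. [folklore] -/
theorem re_conj_mul_self (z : ℂ) : (conj z * z).re = ‖z‖ ^ 2 := by
  rw [Complex.conj_mul', ← Complex.ofReal_pow, Complex.ofReal_re]

/-- `Re(b̄ a) = Re(ā b)`. [folklore] -/
theorem re_conj_mul_comm (a b : ℂ) : (conj b * a).re = (conj a * b).re := by
  rw [← Complex.conj_re (conj a * b), map_mul, Complex.conj_conj, mul_comm]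

/-- `|Re(ā b)| ≤ |a||b|`. [folklore] -/
theorem abs_re_conj_mul_le (a b : ℂ) : |(conj a * b).re| ≤ ‖a‖ * ‖b‖ := by
  refine (Complex.abs_re_le_norm _).trans ?_
  rw [norm_mul, Complex.norm_conj]

/-! ### The grouped expansion -/

/-- **The grouped pair expansion** [LiebSolovej2001, §5]: with the pieces
`pc = ![PᵢPⱼΨ, PᵢQⱼΨ, QᵢPⱼΨ, QᵢQⱼΨ]`, `D α = ∫_{Λⁿ} w|pc α|²` and
`R α β = ∫_{Λⁿ} w Re(conj(pc α) pc β)`, for bounded measurable real `w` and continuous `Ψ`: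
`∫_{Λⁿ} w(xᵢ,xⱼ)|Ψ|² = D 0 + D 1 + D 2 + D 3 + 2(R 0 1 + R 0 2 + R 0 3 + R 1 2 + R 1 3 + R 2 3)`.
[cite: LiebSolovej2001, §5] -/
theorem pair_expansion_grouped {w : Space → Space → ℝ} (hw : Measurable (Function.uncurry w))
    {Wb : ℝ} (hWb : ∀ x y, |w x y| ≤ Wb) (i j : Fin n) {Ψ : Config n → ℂ} (hΨ : Continuous Ψ) :
    ∫ X in cellN n ℓ, w (X i) (X j) * ‖Ψ X‖ ^ 2 =
      (∫ X in cellN n ℓ, w (X i) (X j) * ‖condensatePieces ℓ i j Ψ 0 X‖ ^ 2) +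
      (∫ X in cellN n ℓ, w (X i) (X j) * ‖condensatePieces ℓ i j Ψ 1 X‖ ^ 2) +
      (∫ X in cellN n ℓ, w (X i) (X j) * ‖condensatePieces ℓ i j Ψ 2 X‖ ^ 2) +
      (∫ X in cellN n ℓ, w (X i) (X j) * ‖condensatePieces ℓ i j Ψ 3 X‖ ^ 2) +
      2 * ((∫ X in cellN n ℓ, w (X i) (X j) *
              (conj (condensatePieces ℓ i j Ψ 0 X) * condensatePieces ℓ i j Ψ 1 X).re) +
           (∫ X in cellN n ℓ, w (X i) (X j) *
              (conj (condensatePieces ℓ i j Ψ 0 X) * condensatePieces ℓ i j Ψ 2 X).re) +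
           (∫ X in cellN n ℓ, w (X i) (X j) *
              (conj (condensatePieces ℓ i j Ψ 0 X) * condensatePieces ℓ i j Ψ 3 X).re) +
           (∫ X in cellN n ℓ, w (X i) (X j) *
              (conj (condensatePieces ℓ i j Ψ 1 X) * condensatePieces ℓ i j Ψ 2 X).re) +
           (∫ X in cellN n ℓ, w (X i) (X j) *
              (conj (condensatePieces ℓ i j Ψ 1 X) * condensatePieces ℓ i j Ψ 3 X).re) +
           (∫ X in cellN n ℓ, w (X i) (X j) *
              (conj (condensatePieces ℓ i j Ψ 2 X) * condensatePieces ℓ i j Ψ 3 X).re)) := by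
  set pc := condensatePieces ℓ i j Ψ with hpc
  rw [pair_expansion hw hWb i j hΨ]
  simp only [Fin.sum_univ_four]
  have hd : ∀ α : Fin 4, (∫ X in cellN n ℓ, w (X i) (X j) * (conj (pc α X) * pc α X).re) =
      ∫ X in cellN n ℓ, w (X i) (X j) * ‖pc α X‖ ^ 2 := fun α => by
    simp only [re_conj_mul_self]
  have hs : ∀ α β : Fin 4, (∫ X in cellN n ℓ, w (X i) (X j) * (conj (pc β X) * pc α X).re) =
      ∫ X in cellN n ℓ, w (X i) (X j) * (conj (pc α X) * pc β X).re := fun α β =>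
    integral_congr_ae (Eventually.of_forall fun X => by
      simp only
      rw [re_conj_mul_comm (pc α X) (pc β X)])
  rw [hd 0, hd 1, hd 2, hd 3, hs 0 1, hs 0 2, hs 0 3, hs 1 2, hs 1 3, hs 2 3]
  ring

/-! ### `ℝ≥0∞` majorants of the blocks -/

/-- **A diagonal block as an `ℝ≥0∞` integral**: for `w ≥ 0` jointly measurable and bounded and a
continuous `a`, `∫_{Λⁿ} w(xᵢ,xⱼ)|a|² = (∫⁻_{Λⁿ} w(xᵢ,xⱼ)‖a‖₊²).toReal`. [folklore] -/
theorem diag_block_eq_toReal {w : Space → Space → ℝ} (hw : Measurable (Function.uncurry w))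
    (hw0 : ∀ x y, 0 ≤ w x y) {Wb : ℝ} (hWb : ∀ x y, |w x y| ≤ Wb) (i j : Fin n)
    {a : Config n → ℂ} (ha : Continuous a) :
    ∫ X in cellN n ℓ, w (X i) (X j) * ‖a X‖ ^ 2 =
      (∫⁻ X in cellN n ℓ, ENNReal.ofReal (w (X i) (X j)) * (‖a X‖₊ : ℝ≥0∞) ^ 2).toReal := by
  have hwij : Measurable fun X : Config n => w (X i) (X j) := by
    have e : (fun X : Config n => w (X i) (X j)) = Function.uncurry w ∘ fun X : Config n => (X i, X j) := rfl
    rw [e]; exact hw.comp (by fun_prop)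
  obtain ⟨C, hC⟩ := (isCompact_closedCubeN n ℓ).exists_bound_of_continuousOn ha.continuousOn
  have hWb0 : 0 ≤ Wb := (abs_nonneg _).trans (hWb 0 0)
  have hint : IntegrableOn (fun X => w (X i) (X j) * ‖a X‖ ^ 2) (cellN n ℓ) := by
    refine integrableOn_cellN_of_bounded (hwij.mul (ha.measurable.norm.pow_const 2)) (C := Wb * C ^ 2)
      fun X hX => ?_
    rw [Real.norm_eq_abs, abs_mul, abs_of_nonneg (sq_nonneg ‖a X‖)]
    exact mul_le_mul (hWb _ _) (pow_le_pow_left₀ (norm_nonneg _)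
      (hC X (cellN_subset_closedCubeN n ℓ hX)) 2) (sq_nonneg _) hWb0
  rw [integral_eq_lintegral_of_nonneg_ae (Eventually.of_forall fun X => mul_nonneg (hw0 _ _) (sq_nonneg _))
    hint.aestronglyMeasurable]
  congr 1
  refine lintegral_congr fun X => ?_
  rw [ENNReal.ofReal_mul (hw0 _ _), ← ofReal_norm_sq_eq]

/-- **An off-diagonal block is majorized by `∫⁻ w‖a‖₊‖b‖₊`**: for `w ≥ 0` jointly measurable and
bounded and continuous `a, b`, `|∫_{Λⁿ} w Re(ā b)| ≤ (∫⁻_{Λⁿ} w‖a‖₊‖b‖₊).toReal`. [folklore] -/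
theorem abs_offdiag_block_le_toReal {w : Space → Space → ℝ} (hw : Measurable (Function.uncurry w))
    (hw0 : ∀ x y, 0 ≤ w x y) {Wb : ℝ} (hWb : ∀ x y, |w x y| ≤ Wb) (i j : Fin n)
    {a b : Config n → ℂ} (ha : Continuous a) (hb : Continuous b) :
    |∫ X in cellN n ℓ, w (X i) (X j) * (conj (a X) * b X).re| ≤
      (∫⁻ X in cellN n ℓ, ENNReal.ofReal (w (X i) (X j)) * ((‖a X‖₊ : ℝ≥0∞) * ‖b X‖₊)).toReal := by
  have hwij : Measurable fun X : Config n => w (X i) (X j) := by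
    have e : (fun X : Config n => w (X i) (X j)) = Function.uncurry w ∘ fun X : Config n => (X i, X j) := rfl
    rw [e]; exact hw.comp (by fun_prop)
  obtain ⟨Ca, hCa⟩ := (isCompact_closedCubeN n ℓ).exists_bound_of_continuousOn ha.continuousOn
  obtain ⟨Cb, hCb⟩ := (isCompact_closedCubeN n ℓ).exists_bound_of_continuousOn hb.continuousOn
  have hWb0 : 0 ≤ Wb := (abs_nonneg _).trans (hWb 0 0)
  -- the two integrands and their integrability on the box
  have hmf : Measurable fun X : Config n => w (X i) (X j) * (conj (a X) * b X).re :=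
    hwij.mul (Complex.measurable_re.comp
      ((Complex.continuous_conj.measurable.comp ha.measurable).mul hb.measurable))
  have hmg : Measurable fun X : Config n => w (X i) (X j) * (‖a X‖ * ‖b X‖) :=
    hwij.mul (ha.measurable.norm.mul hb.measurable.norm)
  have hbound : ∀ X ∈ cellN n ℓ, ‖a X‖ * ‖b X‖ ≤ Ca * Cb := fun X hX =>
    mul_le_mul (hCa X (cellN_subset_closedCubeN n ℓ hX)) (hCb X (cellN_subset_closedCubeN n ℓ hX))
      (norm_nonneg _) ((norm_nonneg _).trans (hCa X (cellN_subset_closedCubeN n ℓ hX)))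
  have hintf : IntegrableOn (fun X => w (X i) (X j) * (conj (a X) * b X).re) (cellN n ℓ) := by
    refine integrableOn_cellN_of_bounded hmf (C := Wb * (Ca * Cb)) fun X hX => ?_
    rw [Real.norm_eq_abs, abs_mul]
    exact mul_le_mul (hWb _ _) ((abs_re_conj_mul_le _ _).trans (hbound X hX)) (abs_nonneg _) hWb0
  have hintg : IntegrableOn (fun X => w (X i) (X j) * (‖a X‖ * ‖b X‖)) (cellN n ℓ) := by
    refine integrableOn_cellN_of_bounded hmg (C := Wb * (Ca * Cb)) fun X hX => ?_
    rw [Real.norm_eq_abs, abs_mul, abs_of_nonneg (mul_nonneg (norm_nonneg _) (norm_nonneg _))]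
    exact mul_le_mul (hWb _ _) (hbound X hX) (mul_nonneg (norm_nonneg _) (norm_nonneg _)) hWb0
  -- `|∫f| ≤ ∫|f| ≤ ∫ w|a||b| = toReal ∫⁻ …`
  calc |∫ X in cellN n ℓ, w (X i) (X j) * (conj (a X) * b X).re|
      ≤ ∫ X in cellN n ℓ, |w (X i) (X j) * (conj (a X) * b X).re| := abs_integral_le_integral_abs
    _ ≤ ∫ X in cellN n ℓ, w (X i) (X j) * (‖a X‖ * ‖b X‖) := by
        refine integral_mono hintf.abs hintg fun X => ?_
        simp only
        rw [abs_mul, abs_of_nonneg (hw0 _ _)]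
        exact mul_le_mul_of_nonneg_left (abs_re_conj_mul_le _ _) (hw0 _ _)
    _ = (∫⁻ X in cellN n ℓ, ENNReal.ofReal (w (X i) (X j)) * ((‖a X‖₊ : ℝ≥0∞) * ‖b X‖₊)).toReal := by
        rw [integral_eq_lintegral_of_nonneg_ae (Eventually.of_forall fun X =>
          mul_nonneg (hw0 _ _) (mul_nonneg (norm_nonneg _) (norm_nonneg _))) hintg.aestronglyMeasurable]
        congr 1
        refine lintegral_congr fun X => ?_
        have e1 : ENNReal.ofReal ‖a X‖ = (‖a X‖₊ : ℝ≥0∞) := ENNReal.ofReal_eq_coe_nnreal (norm_nonneg _)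
        have e2 : ENNReal.ofReal ‖b X‖ = (‖b X‖₊ : ℝ≥0∞) := ENNReal.ofReal_eq_coe_nnreal (norm_nonneg _)
        rw [ENNReal.ofReal_mul (hw0 _ _), ENNReal.ofReal_mul (norm_nonneg _), e1, e2]

end Literature.MathematicalPhysics.QuantumManyBody.JelliumBoseGas
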